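import Mathlib
import HarnessLib
import Literature.NumberTheory.LFunctions.WeilExplicit
import Literature.Analysis.Matrix.SchoenbergKernels
import Summits.RiemannHypothesis.RiemannHypothesis.Theses.WeilComb

/-!
# Sketch — crux-ideate `stmt-RiemannHypothesis-11229` (`WeilComb.CombShapePositivity`),
ideator k = 1, round 1: first lemmas of three idea cards, stated over existing declarations.

Nothing here is a proof of anything hard; the three `theorem`s are bookkeeping (glue / restriction)
and everything else is a `def … : Prop`.  The file must elaborate (rc 0).

Notation.  `φ₀(u) = expNegInvGlue (1 - u²)` (the route's fixed bump), `φ_ε = ε⁻¹ φ₀(·/ε)`,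
`ψ_ε = φ_ε ⋆ φ̃_ε`, comb `g = Σ_{m ≤ M} a_m φ_ε(· − log m)`, `Q = Re weilQuadratic g`,
`unit ε = ψ_ε(0) = ε⁻¹ ‖φ₀‖₂²`, `λ = ε·M`, `L = log M`.

* card `pretentious-cone-mertens`   — namespace `PretentiousConeMertens`
* card `bohr-fejer-reduction`       — namespace `BohrFejerReduction`
* card `gal-damping-threshold`      — namespace `GalDamping`
-/

noncomputable section

open scoped BigOperators ComplexConjugate
open Complex MeasureTheory Set

namespace Summit.RiemannHypothesis.RiemannHypothesis.Cruxes.CombShapePositivity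

open Literature.NumberTheory.LFunctions
open Summit.RiemannHypothesis.RiemannHypothesis.Theses

/-! ## Common objects -/

/-- The fixed bump `φ₀`, coerced to `ℂ`. -/
def bump (u : ℝ) : ℂ := ((expNegInvGlue (1 - u ^ 2) : ℝ) : ℂ)

/-- The dilated bump `φ_ε = ε⁻¹ φ₀(·/ε)`. -/
def dil (ε : ℝ) : ℝ → ℂ := fun t : ℝ => (ε : ℂ)⁻¹ * bump (t / ε)

/-- The autocorrelation `ψ_ε = φ_ε ⋆ φ̃_ε` (support `⊆ [-2ε, 2ε]`, `ψ_ε(0) = ε⁻¹‖φ₀‖₂²`). -/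
def psiE (ε : ℝ) : ℝ → ℂ := weilConv (dil ε) (weilReflect (dil ε))

/-- The comb of the crux (syntactically the function inside `WeilComb.CombShapePositivity`). -/
def comb (ε : ℝ) (M : ℕ) (a : ℕ → ℂ) : ℝ → ℂ :=
  fun x : ℝ => ∑ m ∈ Finset.Icc 1 M,
    a m * ((ε : ℂ)⁻¹ * ((expNegInvGlue (1 - ((x - Real.log (m : ℝ)) / ε) ^ 2) : ℝ) : ℂ))

/-- The comb form `Q_ε(a) = Re W(g ⋆ g̃)`. -/
def combQ (ε : ℝ) (M : ℕ) (a : ℕ → ℂ) : ℝ := (weilQuadratic (comb ε M a)).re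

/-- Sanity: the crux is literally `∀ ε > 0, ∀ M a, 0 ≤ combQ ε M a`. -/
example : WeilComb.CombShapePositivity ↔ ∀ ε : ℝ, 0 < ε → ∀ (M : ℕ) (a : ℕ → ℂ), 0 ≤ combQ ε M a :=
  Iff.rfl

/-- The comb kernel `w_ε(x) = Re W(τ_x ψ_ε)` (real and even; `K[m,m'] = w_ε(log m − log m')`). -/
def combKernel (ε x : ℝ) : ℝ := (weilFunctional (fun t : ℝ => psiE ε (t - x))).re

/-- `ψ_ε(0) = ε⁻¹ ‖φ₀‖₂²`, the natural unit of all eigenvalue statements. -/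
def unit (ε : ℝ) : ℝ := ε⁻¹ * ∫ u : ℝ, (expNegInvGlue (1 - u ^ 2)) ^ 2

/-- `‖a‖² = Σ_{m ≤ M} ‖a m‖²`. -/
def l2 (M : ℕ) (a : ℕ → ℂ) : ℝ := ∑ m ∈ Finset.Icc 1 M, ‖a m‖ ^ 2

/-- Dirichlet energy of `a` relative to the Perron cocycle `n^{-1/2}` on the divisor graph
(`D ≥ 0`, `D = 0 ⇔ a_m = a_1 m^{-1/2}`; the sibling crux's lever, reused). -/
def dirichletEnergy (M : ℕ) (a : ℕ → ℂ) : ℝ :=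
  ∑ m ∈ Finset.Icc 1 M, ∑ n ∈ Finset.Icc 1 (M / m),
    (ArithmeticFunction.vonMangoldt n : ℝ) * ‖a (n * m) - ((Real.sqrt n : ℂ))⁻¹ * a m‖ ^ 2

/-- COMB EXPANSION (bookkeeping shared by all three cards): `Q` is the Hermitian multiplicative
Toeplitz form of the kernel `w_ε` on the nodes `log m`. -/
def CombExpansion : Prop :=
  ∀ ε : ℝ, 0 < ε → ∀ (M : ℕ) (a : ℕ → ℂ),
    combQ ε M a =
      ∑ m ∈ Finset.Icc 1 M, ∑ m' ∈ Finset.Icc 1 M,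
        (a m * conj (a m') * (combKernel ε (Real.log m - Real.log m') : ℂ)).re

/-! ## Card 1 — `pretentious-cone-mertens` -/
namespace PretentiousConeMertens

/-- Mean prime term: the prime sum with `Λ` replaced by its mean density,
`∫_0^∞ e^{v/2} (h(v) + h(−v)) dv = ∫_1^∞ x^{-1/2}(h(log x) + h(−log x)) dx`. -/
def weilMeanPrimeTerm (h : ℝ → ℂ) : ℂ :=
  ∫ v in Ioi (0 : ℝ), (Real.exp (v / 2) : ℂ) * (h v + h (-v))

/-- Cauchy term `∫ h(v) e^{-|v|/2} dv` ( `= (1/2π) ∫ ĥ(1/2+it) dt/(1/4+t²)` : the polar term minus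
the mean prime term — the pole of `ζ` spread as a Cauchy density on the critical line). -/
def weilCauchyTerm (h : ℝ → ℂ) : ℂ :=
  ∫ v : ℝ, (Real.exp (-|v| / 2) : ℂ) * h v

/-- The SMOOTH part of the explicit formula: Cauchy + archimedean (no primes). -/
def weilSmoothTerm (h : ℝ → ℂ) : ℂ := weilCauchyTerm h + weilArchTerm h

/-- The prime FLUCTUATION: `Σ Λ(n) n^{-1/2}(h(log n)+h(−log n)) − ∫_1^∞ x^{-1/2}(…) dx`, i.e. the
Stieltjes integral of `x^{-1/2}(h(log x) + h(−log x))` against `d(ψ(x) − x)`. -/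
def weilFluctuation (h : ℝ → ℂ) : ℂ := weilPrimeTerm h - weilMeanPrimeTerm h

/-- FIRST LEMMA (L1, provable now; algebra + `ĥ(0)+ĥ(1) = ∫ h (e^{v/2}+e^{-v/2})`):
`W(h) = smooth(h) − fluctuation(h)`. -/
def SmoothFluctuationSplit : Prop :=
  ∀ h : ℝ → ℂ, IsWeilTest h → weilFunctional h = weilSmoothTerm h - weilFluctuation h

/-- The smooth zero density (times `2π`): `ρ_sm(t) = 1/(1/4+t²) + Re ψ(1/4+it/2) − log π`;
`(1/2π) ρ_sm` is the density of `θ(t)/π + 1`, NEGATIVE for `|t| < t₀ ≈ 6.29`. -/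
def rhoSmooth (t : ℝ) : ℝ :=
  1 / (1 / 4 + t ^ 2) + (Complex.digamma (1 / 4 + t / 2 * I)).re - Real.log Real.pi

/-- (L2) Plancherel form of the smooth part: `Re smooth(g ⋆ g̃) = (1/2π) ∫ |ĝ(1/2+it)|² ρ_sm(t) dt`. -/
def SmoothTermPlancherel : Prop :=
  ∀ g : ℝ → ℂ, IsWeilTest g →
    (weilSmoothTerm (weilConv g (weilReflect g))).re =
      (1 / (2 * Real.pi)) * ∫ t : ℝ, ‖weilMellin g (1 / 2 + t * I)‖ ^ 2 * rhoSmooth t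

/-- (L3) Sign structure of `ρ_sm` (Stirling-type bounds; `ψ(1/4) = −γ − π/2 − 3 log 2`). -/
def RhoSmoothSigns : Prop := rhoSmooth 0 < 0 ∧ ∀ t : ℝ, 7 ≤ |t| → 0 < rhoSmooth t

/-- `𝒜₊(a) := (1/2π) ∫ |ĝ(1/2+it)|² (Re ψ(1/4+it/2) − log π + C₀) dt ≥ 0` for the comb `g`
(the archimedean Gram form shifted to a nonnegative density; `C₀ ≈ 5.37`). -/
def archPlus (C₀ ε : ℝ) (M : ℕ) (a : ℕ → ℂ) : ℝ :=
  (1 / (2 * Real.pi)) * ∫ t : ℝ, ‖weilMellin (comb ε M a) (1 / 2 + t * I)‖ ^ 2 *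
    ((Complex.digamma (1 / 4 + t / 2 * I)).re - Real.log Real.pi + C₀)

/-- Index-coherence deficit `Δ(a) = (log M + C₀ + 1)‖a‖² − 𝒜₊(a)/ψ_ε(0)`: `O(1)·‖a‖²` on
index-rough vectors, `≈ (log M)·‖a_top‖²` on vectors smooth on the index scale `λ` near `m ≈ M`. -/
def coherenceDeficit (C₀ ε : ℝ) (M : ℕ) (a : ℕ → ℂ) : ℝ :=
  (Real.log M + C₀ + 1) * l2 M a - archPlus C₀ ε M a / unit ε

/-- (L4) COERCIVITY DICHOTOMY (the localisation lever): in every window `εM ≤ λ` there is `C(λ)`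
with `Q ≥ ψ_ε(0)·(D(a)/2 − Δ(a) − C(λ)‖a‖²)` (the other half of `D` pays the polar term via the
Helson–Poincaré inequality).  So `Q ≤ 0` forces `D(a) ≤ 2Δ(a) + 2C‖a‖²`: a near-minimiser
is multiplicatively rigid (Perron ray × small-prime data) or index-smooth at the top, or a mixture. -/
def CoercivityDichotomy : Prop :=
  ∃ C₀ : ℝ, (∀ t : ℝ, 0 ≤ (Complex.digamma (1 / 4 + t / 2 * I)).re - Real.log Real.pi + C₀) ∧
    ∀ lam : ℝ, 0 < lam → ∃ C : ℝ, ∀ ε : ℝ, 0 < ε → ∀ (M : ℕ) (a : ℕ → ℂ), 1 ≤ M → ε * M ≤ lam →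
      unit ε * (dirichletEnergy M a / 2 - coherenceDeficit C₀ ε M a - C * l2 M a) ≤ combQ ε M a

/-- THEOREM B₀ (realistic first unconditional target beyond Theorem A): every FIXED window `εM ≤ λ`
is eventually positive — for `M ≥ M₀(λ)` — by localisation to the soft cone + Mertens-type asymptotics
(PNT-strength input only).  The finite range `M < M₀(λ)` is then a certified computation / verified-zeros
statement, not part of this Prop. -/
def WindowPositivity : Prop :=
  ∀ lam : ℝ, 0 < lam → ∃ M₀ : ℕ, ∀ ε : ℝ, 0 < ε → ∀ (M : ℕ) (a : ℕ → ℂ), M₀ ≤ M → ε * M ≤ lam →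
    0 ≤ combQ ε M a

/-- Band positivity with threshold function `c·√(log M)` (the Transfer's provable half, "Theorem B"). -/
def BandPositivityAt (c : ℝ) : Prop :=
  ∀ ε : ℝ, 0 < ε → ∀ (M : ℕ) (a : ℕ → ℂ),
    ε * M ≤ c * Real.sqrt (Real.log M) → 0 ≤ combQ ε M a

/-- The supercritical remainder (zeros individually resolved; the RH-hard core, named honestly). -/
def SupercriticalAt (c : ℝ) : Prop :=
  ∀ ε : ℝ, 0 < ε → ∀ (M : ℕ) (a : ℕ → ℂ),
    c * Real.sqrt (Real.log M) < ε * M → 0 ≤ combQ ε M a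

/-- THEOREM B (unconditional target of the card): band positivity for SOME `c > 0`. -/
def BandPositivity : Prop := ∃ c : ℝ, 0 < c ∧ BandPositivityAt c

/-- Glue of the regime split (pure logic, proved): band ∧ supercritical ⇒ crux. -/
theorem crux_of_split (c : ℝ) (hB : BandPositivityAt c) (hS : SupercriticalAt c) :
    WeilComb.CombShapePositivity := by
  intro ε hε M a
  by_cases h : ε * M ≤ c * Real.sqrt (Real.log M)
  · exact hB ε hε M a h
  · exact hS ε hε M a (lt_of_not_ge h)

end PretentiousConeMertens

/-! ## Card 2 — `bohr-fejer-reduction` -/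
namespace BohrFejerReduction

/-- Bohr character on integers attached to phases `θ_p`: `χ_θ(d) = exp(i Σ_{p∈S} θ_p v_p(d))`
(a completely multiplicative unimodular function of `d`). -/
def bohrChar (S : Finset ℕ) (θ : ℕ → ℝ) (d : ℕ) : ℂ :=
  Complex.exp (I * ((∑ p ∈ S, θ p * (d.factorization p : ℝ) : ℝ) : ℂ))

/-- The box modulus `N = ∏_{p ∈ S} p^n`. -/
def boxModulus (S : Finset ℕ) (n : ℕ) : ℕ := ∏ p ∈ S, p ^ n

/-- The flat divisor-box coefficient vector twisted by a Bohr character: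
`a_d = χ_θ(d)` if `d ∣ N`, else `0`.  Its Dirichlet polynomial is the finite Euler product
`∏_{p∈S} Σ_{k≤n} e^{ikθ_p} p^{-ks}`; on the critical line `|A|² = ∏_p F_n(t log p + θ_p)` (Fejér-type). -/
def boxVector (S : Finset ℕ) (n : ℕ) (θ : ℕ → ℝ) : ℕ → ℂ :=
  fun d => if d ∣ boxModulus S n then bohrChar S θ d else 0

/-- BOHR-BOX POSITIVITY at scale `ε` — the Transfer `C⁺` of the card (an `(|S|+1)`-parameter family
per scale instead of all vectors): every Bohr-twisted flat divisor-box comb has `Q ≥ 0`. -/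
def BohrBoxPositivity (ε : ℝ) : Prop :=
  ∀ S : Finset ℕ, (∀ p ∈ S, p.Prime) → ∀ (n : ℕ) (θ : ℕ → ℝ),
    0 ≤ combQ ε (boxModulus S n) (boxVector S n θ)

/-- Trivial direction (proved): box combs are combs. -/
theorem bohrBox_of_crux (h : WeilComb.CombShapePositivity) :
    ∀ ε : ℝ, 0 < ε → BohrBoxPositivity ε :=
  fun ε hε S _ n θ => h ε hε (boxModulus S n) (boxVector S n θ)

/-- FIRST LEMMA (provable now; one-variable Fejér kernels per prime + averaging over the torus `𝕋^S`):
for an even real kernel `w` on log-ratios, the multiplicative Toeplitz Hermitian form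
`Σ a_m ā_{m'} w(log m − log m')` is `≥ 0` on ALL finitely supported vectors as soon as it is `≥ 0` on
Bohr-twisted flat divisor boxes.  (Proof: `⟨K a,a⟩ = lim_n ∫_{𝕋^S} |P_a(θ)|² ⟨K b^{(θ)}, b^{(θ)}⟩ dθ/(2π)^S`
with `b^{(θ)}` the flat box vector of side `n` twisted by `−θ`; the weights `∏(1 − |v_p|/n)₊ → 1`.) -/
def ProductVectorReduction : Prop :=
  ∀ w : ℝ → ℝ, (∀ x : ℝ, w (-x) = w x) →
    (∀ S : Finset ℕ, (∀ p ∈ S, p.Prime) → ∀ (n : ℕ) (θ : ℕ → ℝ),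
      0 ≤ ∑ d ∈ (boxModulus S n).divisors, ∑ d' ∈ (boxModulus S n).divisors,
        (bohrChar S θ d * conj (bohrChar S θ d') * (w (Real.log d - Real.log d') : ℂ)).re) →
    ∀ (M : ℕ) (a : ℕ → ℂ),
      0 ≤ ∑ m ∈ Finset.Icc 1 M, ∑ m' ∈ Finset.Icc 1 M,
        (a m * conj (a m') * (w (Real.log m - Real.log m') : ℂ)).re

/-- THE REDUCTION for the crux (= `ProductVectorReduction` for `w = combKernel ε` + `CombExpansion`):
Bohr-box positivity at every scale ⇒ `CombShapePositivity`. With `bohrBox_of_crux` an EQUIVALENCE. -/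
def BohrFejerReduction : Prop :=
  (∀ ε : ℝ, 0 < ε → BohrBoxPositivity ε) → WeilComb.CombShapePositivity

/-- Pointwise form: the Fejér mean of the comb symbol,
`P_{S,n,ε}(θ) = Σ_{d,d' ∣ N} χ_θ(d) χ̄_θ(d') w_ε(log d − log d')`, a trigonometric polynomial on `𝕋^S`. -/
def fejerMean (ε : ℝ) (S : Finset ℕ) (n : ℕ) (θ : ℕ → ℝ) : ℝ :=
  ∑ d ∈ (boxModulus S n).divisors, ∑ d' ∈ (boxModulus S n).divisors,
    (bohrChar S θ d * conj (bohrChar S θ d') * (combKernel ε (Real.log d - Real.log d') : ℂ)).re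

/-- `C⁺` restated as pointwise nonnegativity of explicit trigonometric polynomials on tori. -/
def FejerMeansNonneg : Prop :=
  ∀ ε : ℝ, 0 < ε → ∀ S : Finset ℕ, (∀ p ∈ S, p.Prime) → ∀ (n : ℕ) (θ : ℕ → ℝ), 0 ≤ fejerMean ε S n θ

/-- ONE-PRIME TOWER face (classical Carathéodory–Toeplitz): the sequence `k ↦ w_ε(k log p)` is
positive definite on `ℤ`, i.e. every Toeplitz section is PSD. RH-implied; its Schur parameters give
explicit RH-inequalities computable from primes near powers of `p`. -/
def TowerPositivity (ε : ℝ) (p : ℕ) : Prop :=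
  ∀ (n : ℕ) (c : ℕ → ℂ),
    0 ≤ ∑ k ∈ Finset.range n, ∑ l ∈ Finset.range n,
      (c k * conj (c l) * (combKernel ε ((k : ℝ) * Real.log p - (l : ℝ) * Real.log p) : ℂ)).re

/-- `{2,3}`-smooth integers. -/
def IsSmooth23 (m : ℕ) : Prop := ∃ i j : ℕ, m = 2 ^ i * 3 ^ j

/-- TWO-PRIME LATTICE face: comb positivity for coefficient vectors supported on `2^i 3^j`. -/
def Skeleton23Positivity : Prop :=
  ∀ ε : ℝ, 0 < ε → ∀ (M : ℕ) (a : ℕ → ℂ), (∀ m : ℕ, ¬ IsSmooth23 m → a m = 0) → 0 ≤ combQ ε M a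

/-- Two-prime detection (provable now, by the in-tree WeilConverse argument with lags in the dense
subgroup `ℤ log 2 + ℤ log 3`): the two-prime lattice face is already RH-complete. -/
def TwoPrimeDetection : Prop := Skeleton23Positivity → RiemannHypothesis

end BohrFejerReduction

/-! ## Card 3 — `gal-damping-threshold` -/
namespace GalDamping

/-- Gál kernel `G_α(m,m') = (gcd(m,m')²/(m m'))^α = e^{-α·ℓ(m/m')}`, `ℓ(a/b) = log(ab)` the log-height. -/
def galKernel (α : ℝ) (m m' : ℕ) : ℝ := ((Nat.gcd m m' : ℝ) ^ 2 / ((m : ℝ) * m')) ^ α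

/-- Jordan-type totient `J_s(k) = k^s ∏_{p ∣ k} (1 − p^{-s})` (`≥ 0` for `s ≥ 0`). -/
def jordanTotient (s : ℝ) (k : ℕ) : ℝ :=
  (k : ℝ) ^ s * ∏ p ∈ k.primeFactors, (1 - (p : ℝ) ^ (-s))

/-- FIRST LEMMA (Smith–Selberg `LDLᵀ` over the divisor poset, provable now):
`G_α(m,m') = (m m')^{-α} Σ_{k ∣ gcd(m,m')} J_{2α}(k)`; hence `G_α` is a positive definite kernel on `ℕ⁺`
and `{G_α}_{α ≥ 0}` is a Schur-multiplier semigroup (`G_α ∘ G_β = G_{α+β}`). -/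
def SmithFactorisation : Prop :=
  ∀ α : ℝ, 0 ≤ α → ∀ m m' : ℕ, 1 ≤ m → 1 ≤ m' →
    galKernel α m m' = ((m : ℝ) * m') ^ (-α) * ∑ k ∈ (Nat.gcd m m').divisors, jordanTotient (2 * α) k

/-- `G_α` is a positive definite kernel on the positive integers (`IsPosDefKernel` of the tree's
Schoenberg file), for every `α ≥ 0`. -/
def GalKernelPosDef : Prop :=
  ∀ α : ℝ, 0 ≤ α → Literature.Analysis.Matrix.IsPosDefKernel (fun m m' : ℕ+ => galKernel α m m')

/-- Damped comb positivity at level `α`: the Schur product `K^ε ∘ G_α` is PSD. -/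
def DampedCombPositivity (α : ℝ) : Prop :=
  ∀ ε : ℝ, 0 < ε → ∀ (M : ℕ) (a : ℕ → ℂ),
    0 ≤ ∑ m ∈ Finset.Icc 1 M, ∑ m' ∈ Finset.Icc 1 M,
      (a m * conj (a m') * ((combKernel ε (Real.log m - Real.log m') * galKernel α m m' : ℝ) : ℂ)).re

/-- Monotonicity (Schur product theorem `Matrix.PosSemidef.hadamard` + semigroup): an up-set in `α`. -/
def DampedMonotone : Prop :=
  ∀ α β : ℝ, 0 ≤ α → α ≤ β → DampedCombPositivity α → DampedCombPositivity β

/-- Threshold statement (closedness of the PSD cone as `α → 0⁺`, with `CombExpansion`):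
damped positivity for all `α > 0` ⇒ the crux. So RH ⇔ the threshold `α*` vanishes identically. -/
def ThresholdZero : Prop := (∀ α : ℝ, 0 < α → DampedCombPositivity α) → WeilComb.CombShapePositivity

/-- Necessary chain (Landau on the 2×2 minors at lags `log n`): damped positivity at level `α`
forces the quasi-Riemann hypothesis `Re ρ ≤ 1/2 + α`. -/
def DampedImpliesQuasiRH : Prop :=
  ∀ α : ℝ, 0 ≤ α → DampedCombPositivity α →
    ∀ ρ : ℂ, riemannZeta ρ = 0 → 0 < ρ.re → ρ.re < 1 → ρ.re ≤ 1 / 2 + α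

end GalDamping

end Summit.RiemannHypothesis.RiemannHypothesis.Cruxes.CombShapePositivity

end
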